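import Mathlib
import HarnessLib
import HarnessLib.Audit
import Summits.CriticalPhenomena.PercolationContinuityZ3.Theorems.PercNearOneGluingNoHeavyLowerTailHexMSDelta

/-!
# The matching form of Marica–Schönheim, and the same-label case of Conjecture (MATCH) for HEX-MS (hp-7 gen 67)

Support file for crux `stmt-CriticalPhenomena-4575` (route `PercNearOneGluingNoHeavy`), hull-port seat `prim-hp-7` (generation 67);
`--supports stmt-CriticalPhenomena-4575`.  No `sorry`.  Memo: `run/shared/lean/prim/prim-hp-7/FROM-prim-hp-7-g67-EXTREME-DIRECTIONS.md` §6.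

Call a member `a` of a set family `F` **Δ-dead** if it is not a difference of two members (`a ∉ F \\ F`).  Gen 67 observed (exhaustively for
all 65 535 families on 4 points, sampled to 6 points) and proves here:

* `sdiff_notMem_of_dead` — if `a ∈ F` is Δ-dead then no `b \ a` (`b ∈ F`) is a member (a member disjoint from `a` would exhibit
  `a = a \ (b \ a)` as a difference);
* `diffs_subset_candidates_of_dead` — hence for a family `A ⊆ F` of Δ-dead members, every difference of two members of `A` is a NON-member
  difference `a \ g` (`a ∈ A`, `g ∈ F`);
* `card_le_card_candidates_of_dead` (**Hall's condition**) `#A ≤ #((A \\ F) \ F)` via Marica–Schönheim `#A ≤ #(A \\ A)`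
  (`Finset.card_le_card_diffs`), and
* `exists_injective_dead_to_nonmember_diff` (**matching form of Marica–Schönheim**): the Δ-dead members of `F` can be sent INJECTIVELY to
  pairwise distinct non-members of the form `a \ g`, `g ∈ F` (Hall's marriage theorem).
  In particular `#(F \ (F \\ F)) ≤ #((F \\ F) \ F)`, a refinement of `#F ≤ #(F \\ F)`.

The HEX analogue is gen 67's Conjecture (MATCH) (memo §6): in an antipodal instance every member of `𝒟` that is not a far meet/join can be
matched injectively to an absent far meet/join `s ∩ d` / `s ∪ d` of itself (⟹ Δ-HEX ⟹ HEX-MS; verified exactly for n ≤ 5, exhaustively for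
n = 4).  Here we prove its **same-label part**: `sdiff_notMem_of_dead_of_label_eq` — for two dead members with equal labels the difference
`s \ s'` is a generated set and is NOT a member (a member below `s` must be label-close to `s`, a member disjoint from `s'` must be
label-far from `s'`), so the same-label differences are always available as matching targets (`diffs_subset_gen_sdiff_of_dead`).
-/

namespace Summit.CriticalPhenomena.PercolationContinuityZ3.Theorems

namespace GeneratedDonors

open Finset FinsetFamily

variable {α : Type*} [DecidableEq α]

section MaricaSchoenheimMatching

/-- If `a ∈ F` is not a difference of two members of `F`, then no `b \ a` with `b ∈ F` is a member of `F`. -/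
theorem sdiff_notMem_of_dead {F : Finset (Finset α)} {a : Finset α} (b : Finset α) (ha : a ∈ F)
    (hdead : a ∉ F \\ F) : b \ a ∉ F := by
  intro h
  apply hdead
  rw [Finset.mem_diffs]
  refine ⟨a, ha, b \ a, h, ?_⟩
  rw [Finset.sdiff_eq_self_iff_disjoint]
  exact Finset.disjoint_sdiff

/-- For a family `A ⊆ F` of Δ-dead members, every difference of two members of `A` is a non-member of `F` of the form `a \ g`, `g ∈ F`. -/
theorem diffs_subset_candidates_of_dead {F A : Finset (Finset α)} (hAF : A ⊆ F) (hdead : ∀ a ∈ A, a ∉ F \\ F) :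
    A \\ A ⊆ (A \\ F) \ F := by
  intro c hc
  rw [Finset.mem_diffs] at hc
  obtain ⟨a, ha, b, hb, rfl⟩ := hc
  rw [mem_sdiff]
  exact ⟨Finset.sdiff_mem_diffs ha (hAF hb), sdiff_notMem_of_dead a (hAF hb) (hdead b hb)⟩

/-- **Hall's condition for the Δ-dead members** (Marica–Schönheim applied to `A`): `#A ≤ #((A \\ F) \ F)`. -/
theorem card_le_card_candidates_of_dead {F A : Finset (Finset α)} (hAF : A ⊆ F) (hdead : ∀ a ∈ A, a ∉ F \\ F) :
    #A ≤ #((A \\ F) \ F) :=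
  A.card_le_card_diffs.trans (card_le_card (diffs_subset_candidates_of_dead hAF hdead))

/-- **The matching form of Marica–Schönheim.**  The members of `F` that are not differences of two members can be mapped injectively to
non-members of `F`, each of the form `a \ g` with `g ∈ F`. -/
theorem exists_injective_dead_to_nonmember_diff (F : Finset (Finset α)) :
    ∃ ψ : Finset α → Finset α, Set.InjOn ψ ↑(F \ (F \\ F)) ∧
      ∀ a ∈ F \ (F \\ F), ψ a ∉ F ∧ ∃ g ∈ F, ψ a = a \ g := by
  classical
  -- Hall's marriage theorem on the index type `ι = {a // a ∈ F \ (F \\ F)}` with candidate sets `t a = ({a} \\ F) \ F`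
  let ι := {a : Finset α // a ∈ F \ (F \\ F)}
  let t : ι → Finset (Finset α) := fun a => (({a.val} : Finset (Finset α)) \\ F) \ F
  have hall : ∀ s : Finset ι, #s ≤ #(s.biUnion t) := by
    intro s
    have hAF : s.image Subtype.val ⊆ F := by
      intro a ha
      obtain ⟨a', _, ha'⟩ := mem_image.mp ha
      rw [← ha']; exact (mem_sdiff.mp a'.property).1
    have hdead : ∀ a ∈ s.image Subtype.val, a ∉ F \\ F := by
      intro a ha
      obtain ⟨a', _, ha'⟩ := mem_image.mp ha
      rw [← ha']; exact (mem_sdiff.mp a'.property).2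
    have hcardA : #(s.image Subtype.val) = #s := card_image_of_injective _ Subtype.val_injective
    have hsub : ((s.image Subtype.val) \\ F) \ F ⊆ s.biUnion t := by
      intro c hc
      rw [mem_sdiff, Finset.mem_diffs] at hc
      obtain ⟨⟨a, ha, g, hg, hc⟩, hcF⟩ := hc
      obtain ⟨a', ha', haa⟩ := mem_image.mp ha
      rw [mem_biUnion]
      refine ⟨a', ha', ?_⟩
      show c ∈ (({a'.val} : Finset (Finset α)) \\ F) \ F
      rw [mem_sdiff]
      refine ⟨?_, hcF⟩
      rw [← hc, ← haa]
      exact Finset.sdiff_mem_diffs (mem_singleton_self _) hg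
    calc #s = #(s.image Subtype.val) := hcardA.symm
      _ ≤ #(((s.image Subtype.val) \\ F) \ F) := card_le_card_candidates_of_dead hAF hdead
      _ ≤ #(s.biUnion t) := card_le_card hsub
  obtain ⟨f, hfinj, hft⟩ := (Finset.all_card_le_biUnion_card_iff_exists_injective t).mp hall
  refine ⟨fun a => if h : a ∈ F \ (F \\ F) then f ⟨a, h⟩ else a, ?_, ?_⟩
  · intro a ha b hb hab
    have ha' : a ∈ F \ (F \\ F) := ha
    have hb' : b ∈ F \ (F \\ F) := hb
    simp only [dif_pos ha', dif_pos hb'] at hab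
    exact congrArg Subtype.val (hfinj hab)
  · intro a ha
    simp only [dif_pos ha]
    have hmem : f ⟨a, ha⟩ ∈ (({a} : Finset (Finset α)) \\ F) \ F := hft ⟨a, ha⟩
    rw [mem_sdiff, Finset.mem_diffs] at hmem
    obtain ⟨⟨a₀, ha₀, g, hg, hfg⟩, hnot⟩ := hmem
    rw [mem_singleton] at ha₀
    exact ⟨hnot, g, hg, by rw [← hfg, ha₀]⟩

/-- Counting corollary: the Δ-dead members are at most as many as the non-member differences. -/
theorem card_dead_le_card_nonmember_diffs (F : Finset (Finset α)) : #(F \ (F \\ F)) ≤ #((F \\ F) \ F) :=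
  (card_le_card_candidates_of_dead (F := F) (A := F \ (F \\ F)) sdiff_subset
    (fun _ ha => (mem_sdiff.mp ha).2)).trans (card_le_card (sdiff_subset_sdiff (diffs_subset_right sdiff_subset) le_rfl))

end MaricaSchoenheimMatching

section HexSameLabel

variable {U : Finset α} {𝒟 : Finset (Finset α)} {x : Finset α → ZMod 6}

/-- In an antipodal instance on `U`: a member `t ⊆ s` of `𝒟` with a label far from that of `s ∈ 𝒟` makes `s` a far join, hence
`s ∈ symGen U 𝒟 x`. -/
theorem mem_symGen_of_subset_far (hU : ∀ a ∈ 𝒟, a ⊆ U) (hco : ∀ a ∈ 𝒟, U \ a ∈ 𝒟)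
    (hanti : ∀ a ∈ 𝒟, x (U \ a) = x a + 3) {s t : Finset α} (hs : s ∈ 𝒟) (ht : t ∈ 𝒟) (hts : t ⊆ s)
    (hfar : ¬ Close (x t) (x s)) : s ∈ symGen U 𝒟 x := by
  -- s = U \ ((U \ s) \ t) and (U \ s) \ t ∈ gen since x (U \ s) = x s + 3 is close to x t
  have key : ∀ a b : ZMod 6, ¬ Close a b → Close (b + 3) a := by decide
  have hgen : (U \ s) \ t ∈ gen 𝒟 x :=
    mem_gen.mpr ⟨U \ s, hco s hs, t, ht, by rw [hanti s hs]; exact key _ _ hfar, rfl⟩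
  have hst : (U \ s) \ t = U \ s := by
    rw [Finset.sdiff_eq_self_iff_disjoint]
    exact disjoint_of_subset_right hts disjoint_sdiff_self_left
  unfold symGen
  refine mem_union_right _ (mem_image.mpr ⟨(U \ s) \ t, hgen, ?_⟩)
  rw [hst, Finset.sdiff_sdiff_eq_self (hU s hs)]

/-- In an antipodal instance: a member `t` of `𝒟` disjoint from `s ∈ 𝒟` with a label close to that of `s` makes `s = s \ t` a generated
difference, hence `s ∈ symGen U 𝒟 x`. -/
theorem mem_symGen_of_disjoint_close {s t : Finset α} (hs : s ∈ 𝒟) (ht : t ∈ 𝒟)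
    (hdis : Disjoint s t) (hcl : Close (x s) (x t)) : s ∈ symGen U 𝒟 x := by
  have hgen : s \ t ∈ gen 𝒟 x := mem_gen.mpr ⟨s, hs, t, ht, hcl, rfl⟩
  rw [Finset.sdiff_eq_self_iff_disjoint.mpr hdis] at hgen
  unfold symGen
  exact mem_union_left _ hgen

/-- **Same-label part of Conjecture (MATCH).**  If `s, s' ∈ 𝒟` are both dead (not in `symGen`) and carry the same label, then `s \ s'` is a
generated difference which is NOT a member of `𝒟`. -/
theorem sdiff_notMem_of_dead_of_label_eq (hU : ∀ a ∈ 𝒟, a ⊆ U) (hco : ∀ a ∈ 𝒟, U \ a ∈ 𝒟)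
    (hanti : ∀ a ∈ 𝒟, x (U \ a) = x a + 3) {s s' : Finset α} (hs : s ∈ 𝒟) (hs' : s' ∈ 𝒟)
    (hdead : s ∉ symGen U 𝒟 x) (hdead' : s' ∉ symGen U 𝒟 x) (hlab : x s = x s') :
    s \ s' ∈ gen 𝒟 x ∧ s \ s' ∉ 𝒟 := by
  refine ⟨mem_gen.mpr ⟨s, hs, s', hs', by rw [hlab]; exact Or.inl rfl, rfl⟩, ?_⟩
  intro hmem
  by_cases hc : Close (x (s \ s')) (x s)
  · -- s \ s' is disjoint from s' and close to x s' = x s: s' would be generated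
    exact hdead' (mem_symGen_of_disjoint_close hs' hmem disjoint_sdiff_self_right
      (by rw [← hlab]; exact (close_comm _ _).mp hc))
  · -- s \ s' ⊆ s with a far label: s would be a far join
    exact hdead (mem_symGen_of_subset_far hU hco hanti hs hmem sdiff_subset hc)

/-- Hence for a family `A` of dead members of one label, all differences `A \\ A` are generated non-members:
`A \\ A ⊆ gen 𝒟 x \ 𝒟` (so at least `#A` matching targets of the form `s \ s' = s ∩ (U \ s')` are available, by Marica–Schönheim). -/
theorem diffs_subset_gen_sdiff_of_dead (hU : ∀ a ∈ 𝒟, a ⊆ U) (hco : ∀ a ∈ 𝒟, U \ a ∈ 𝒟)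
    (hanti : ∀ a ∈ 𝒟, x (U \ a) = x a + 3) {A : Finset (Finset α)} {ℓ : ZMod 6} (hA : A ⊆ 𝒟)
    (hdead : ∀ s ∈ A, s ∉ symGen U 𝒟 x) (hlab : ∀ s ∈ A, x s = ℓ) :
    A \\ A ⊆ gen 𝒟 x \ 𝒟 := by
  intro c hc
  rw [Finset.mem_diffs] at hc
  obtain ⟨s, hs, s', hs', rfl⟩ := hc
  obtain ⟨h1, h2⟩ := sdiff_notMem_of_dead_of_label_eq hU hco hanti (hA hs) (hA hs') (hdead s hs) (hdead s' hs')
    (by rw [hlab s hs, hlab s' hs'])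
  exact mem_sdiff.mpr ⟨h1, h2⟩

/-- Counting form of the same-label part: `#A ≤ #(gen 𝒟 x \ 𝒟)` for every family `A` of equally-labelled dead members. -/
theorem card_le_card_gen_sdiff_of_dead (hU : ∀ a ∈ 𝒟, a ⊆ U) (hco : ∀ a ∈ 𝒟, U \ a ∈ 𝒟)
    (hanti : ∀ a ∈ 𝒟, x (U \ a) = x a + 3) {A : Finset (Finset α)} {ℓ : ZMod 6} (hA : A ⊆ 𝒟)
    (hdead : ∀ s ∈ A, s ∉ symGen U 𝒟 x) (hlab : ∀ s ∈ A, x s = ℓ) :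
    #A ≤ #(gen 𝒟 x \ 𝒟) :=
  A.card_le_card_diffs.trans (card_le_card (diffs_subset_gen_sdiff_of_dead hU hco hanti hA hdead hlab))

end HexSameLabel

end GeneratedDonors

end Summit.CriticalPhenomena.PercolationContinuityZ3.Theorems
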